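import Literature.Computability.AlgebraicComplexity.BurgisserPerturbedCharpolyHeight
import Literature.Computability.AlgebraicComplexity.BurgisserBooleanPartsA3Steps
import HarnessLib

/-!
# Heights for the perturbed characteristic polynomial over a polynomial base ring `ℤ[τ]`

Topic: `Literature/Computability/AlgebraicComplexity`; the parametric version of
`BurgisserPerturbedCharpolyHeight.lean`. There the square system `F_1, …, F_n` has INTEGER
coefficients and the weight bound `wt(Q_u) ≤ (1 + W^k · wt(u))^(Dⁿ)` for the leading `s`-form
`Q_u = sLead (pertCharpoly D F u k)` (Canny's generalised characteristic polynomial,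
J. Symbolic Comput. 9 (1990), §3; Bürgisser 2000 TCS Thm. 4.5, "`log wt = d^{O(n)} log w`") is
proved by the `ℓ¹`-norm calculus. When the coefficients are themselves integer polynomials in
parameters `τ` (a positive-dimensional Kronecker parametrisation, indeterminate combination
coefficients, a generic linear form), the same calculus applies verbatim to the TOTAL weight —
the `ℓ¹` norm of all integer coefficients — which is again subadditive and submultiplicative:

* `weight_coeff_sLead_pertCharpoly_le` — for `F_i ∈ ℤ[τ][X_1, …, X_n]` of total weight `≤ W`
  (`W ≥ 1`) and `u` of total weight `≤ Wᵤ`, **every coefficient of `Q_u ∈ ℤ[τ][T]` has weight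
  `≤ (1 + W^k · Wᵤ)^(Dⁿ)`**; `sum_weight_coeff_sLead_pertCharpoly_le` — the same for the total
  weight of `Q_u`.

(Private total-weight functions `tW`, `sW`, `bW` on `ℤ[τ][s]`, `ℤ[τ][s][X]`, `ℤ[τ][s][T]` and
their calculus; the column bound `W^k Wᵤ` and the Leibniz expansion are as in the integer case.)

## References

* P. Bürgisser, *Cook's versus Valiant's hypothesis*, TCS 235 (2000), Thm. 4.5 (p. 82).
  [Burgisser2000TCS]
* J. Canny, *Generalised characteristic polynomials*, J. Symbolic Comput. 9 (1990), §3.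
  [Canny1990GCP]
-/

noncomputable section

open Polynomial
open Literature.RingTheory.Elimination

namespace Literature.Computability.AlgebraicComplexity

variable {τ : Type*}

/-! ### Total weight on `ℤ[τ][s]` -/

section TW

/-- `tW a`: the total weight (sum of the weights of the `s`-coefficients) of `a ∈ ℤ[τ][s]`.
[folklore] -/
private def tW (a : Polynomial (MvPolynomial τ ℤ)) : ℕ := a.support.sum fun j => weight (a.coeff j)

/-- `tW` over a superset of the support. [folklore] -/
private theorem tW_eq_sum_of_support_subset (a : Polynomial (MvPolynomial τ ℤ)) {S : Finset ℕ}
    (hS : a.support ⊆ S) : tW a = ∑ j ∈ S, weight (a.coeff j) := by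
  unfold tW
  refine Finset.sum_subset hS fun j _ hj => ?_
  rw [Polynomial.notMem_support_iff.1 hj, weight_zero]

/-- Coefficients are bounded by the total weight. [folklore] -/
private theorem weight_coeff_le_tW (a : Polynomial (MvPolynomial τ ℤ)) (j : ℕ) : weight (a.coeff j) ≤ tW a := by
  classical
  by_cases hj : j ∈ a.support
  · exact Finset.single_le_sum (f := fun j => weight (a.coeff j)) (fun _ _ => Nat.zero_le _) hj
  · rw [Polynomial.notMem_support_iff.1 hj, weight_zero]; exact Nat.zero_le _

/-- `tW 0 = 0`. [folklore] -/
@[simp] private theorem tW_zero : tW (0 : Polynomial (MvPolynomial τ ℤ)) = 0 := by simp [tW]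

/-- `tW (monomial k b) = wt b`. [folklore] -/
private theorem tW_monomial (k : ℕ) (b : MvPolynomial τ ℤ) : tW (Polynomial.monomial k b) = weight b := by
  classical
  rcases eq_or_ne b 0 with rfl | hb
  · simp
  · rw [tW, Polynomial.support_monomial _ hb, Finset.sum_singleton, Polynomial.coeff_monomial, if_pos rfl]

/-- `tW (C b) = wt b`. [folklore] -/
@[simp] private theorem tW_C (b : MvPolynomial τ ℤ) : tW (Polynomial.C b) = weight b := by
  rw [← Polynomial.monomial_zero_left, tW_monomial]

/-- `tW s = 1`. [folklore] -/
@[simp] private theorem tW_X : tW (Polynomial.X : Polynomial (MvPolynomial τ ℤ)) = 1 := by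
  rw [← Polynomial.monomial_one_one_eq_X, tW_monomial, weight_one]

/-- `tW 1 = 1`. [folklore] -/
@[simp] private theorem tW_one : tW (1 : Polynomial (MvPolynomial τ ℤ)) = 1 := by
  rw [← Polynomial.C_1, tW_C, weight_one]

/-- Subadditivity. [folklore] -/
private theorem tW_add_le (a b : Polynomial (MvPolynomial τ ℤ)) : tW (a + b) ≤ tW a + tW b := by
  classical
  rw [tW_eq_sum_of_support_subset (a + b) Polynomial.support_add,
    tW_eq_sum_of_support_subset a Finset.subset_union_left,
    tW_eq_sum_of_support_subset b Finset.subset_union_right, ← Finset.sum_add_distrib]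
  exact Finset.sum_le_sum fun j _ => by rw [Polynomial.coeff_add]; exact weight_add_le _ _

/-- `tW (-a) = tW a`. [folklore] -/
@[simp] private theorem tW_neg (a : Polynomial (MvPolynomial τ ℤ)) : tW (-a) = tW a := by
  simp [tW, Polynomial.support_neg]

/-- `tW (a - b) ≤ tW a + tW b`. [folklore] -/
private theorem tW_sub_le (a b : Polynomial (MvPolynomial τ ℤ)) : tW (a - b) ≤ tW a + tW b := by
  have h := tW_add_le a (-b)
  rw [tW_neg] at h
  rw [show a - b = a + -b by ring]
  exact h

/-- Finite sums. [folklore] -/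
private theorem tW_sum_le {ι : Type*} (s : Finset ι) (f : ι → Polynomial (MvPolynomial τ ℤ)) :
    tW (∑ i ∈ s, f i) ≤ ∑ i ∈ s, tW (f i) := by
  classical
  induction s using Finset.cons_induction with
  | empty => simp
  | cons a s ha ih =>
    rw [Finset.sum_cons, Finset.sum_cons]
    exact (tW_add_le _ _).trans (Nat.add_le_add_left ih _)

/-- Submultiplicativity. [folklore] -/
private theorem tW_mul_le (a b : Polynomial (MvPolynomial τ ℤ)) : tW (a * b) ≤ tW a * tW b := by
  classical
  rw [Polynomial.mul_eq_sum_sum]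
  refine (tW_sum_le _ _).trans ?_
  calc ∑ i ∈ a.support, tW (b.sum fun j c => Polynomial.monomial (i + j) (a.coeff i * c))
      ≤ ∑ i ∈ a.support, ∑ j ∈ b.support, weight (a.coeff i) * weight (b.coeff j) := by
        refine Finset.sum_le_sum fun i _ => ?_
        rw [Polynomial.sum_def]
        refine (tW_sum_le _ _).trans (Finset.sum_le_sum fun j _ => ?_)
        rw [tW_monomial]
        exact weight_mul_le _ _
    _ = tW a * tW b := by rw [tW, tW, Finset.sum_mul_sum]

/-- Products. [folklore] -/
private theorem tW_prod_le {ι : Type*} (s : Finset ι) (f : ι → Polynomial (MvPolynomial τ ℤ)) :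
    tW (∏ i ∈ s, f i) ≤ ∏ i ∈ s, tW (f i) := by
  classical
  induction s using Finset.cons_induction with
  | empty => rw [Finset.prod_empty, Finset.prod_empty, tW_one]
  | cons a s ha ih =>
    rw [Finset.prod_cons, Finset.prod_cons]
    exact (tW_mul_le _ _).trans (Nat.mul_le_mul_left _ ih)

end TW

/-! ### Total weight on `ℤ[τ][s][X_1, …, X_n]` -/

section SW

variable {σ : Type*}

/-- `sW q`: the total weight of `q ∈ ℤ[τ][s][X_σ]`. [folklore] -/
private def sW (q : MvPolynomial σ (Polynomial (MvPolynomial τ ℤ))) : ℕ :=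
  q.support.sum fun β => tW (MvPolynomial.coeff β q)

/-- `sW` over a superset of the support. [folklore] -/
private theorem sW_eq_sum_of_support_subset (q : MvPolynomial σ (Polynomial (MvPolynomial τ ℤ)))
    {S : Finset (σ →₀ ℕ)} (hS : q.support ⊆ S) : sW q = ∑ β ∈ S, tW (MvPolynomial.coeff β q) := by
  unfold sW
  refine Finset.sum_subset hS fun β _ hβ => ?_
  rw [MvPolynomial.notMem_support_iff.1 hβ, tW_zero]

/-- `sW 0 = 0`. [folklore] -/
@[simp] private theorem sW_zero : sW (0 : MvPolynomial σ (Polynomial (MvPolynomial τ ℤ))) = 0 := by simp [sW]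

/-- Monomials. [folklore] -/
private theorem sW_monomial (β : σ →₀ ℕ) (a : Polynomial (MvPolynomial τ ℤ)) :
    sW (MvPolynomial.monomial β a) = tW a := by
  classical
  rcases eq_or_ne a 0 with rfl | ha
  · simp
  · rw [sW, MvPolynomial.support_monomial, if_neg ha, Finset.sum_singleton,
      MvPolynomial.coeff_monomial, if_pos rfl]

/-- Subadditivity. [folklore] -/
private theorem sW_add_le (p q : MvPolynomial σ (Polynomial (MvPolynomial τ ℤ))) : sW (p + q) ≤ sW p + sW q := by
  classical
  rw [sW_eq_sum_of_support_subset (p + q) (MvPolynomial.support_add (p := p) (q := q)),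
    sW_eq_sum_of_support_subset p Finset.subset_union_left,
    sW_eq_sum_of_support_subset q Finset.subset_union_right, ← Finset.sum_add_distrib]
  exact Finset.sum_le_sum fun β _ => by rw [MvPolynomial.coeff_add]; exact tW_add_le _ _

/-- Finite sums. [folklore] -/
private theorem sW_sum_le {ι : Type*} (s : Finset ι) (f : ι → MvPolynomial σ (Polynomial (MvPolynomial τ ℤ))) :
    sW (∑ i ∈ s, f i) ≤ ∑ i ∈ s, sW (f i) := by
  classical
  induction s using Finset.cons_induction with
  | empty => simp
  | cons a s ha ih =>
    rw [Finset.sum_cons, Finset.sum_cons]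
    exact (sW_add_le _ _).trans (Nat.add_le_add_left ih _)

/-- `sW (-q) = sW q`. [folklore] -/
@[simp] private theorem sW_neg (q : MvPolynomial σ (Polynomial (MvPolynomial τ ℤ))) : sW (-q) = sW q := by
  simp [sW, MvPolynomial.support_neg]

/-- `sW (monomial β a * q) ≤ tW a · sW q`. [folklore] -/
private theorem sW_monomial_mul_le (β : σ →₀ ℕ) (a : Polynomial (MvPolynomial τ ℤ))
    (q : MvPolynomial σ (Polynomial (MvPolynomial τ ℤ))) :
    sW (MvPolynomial.monomial β a * q) ≤ tW a * sW q := by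
  classical
  have hq : MvPolynomial.monomial β a * q =
      ∑ γ ∈ q.support, MvPolynomial.monomial (β + γ) (a * MvPolynomial.coeff γ q) := by
    conv_lhs => rw [← MvPolynomial.support_sum_monomial_coeff q, Finset.mul_sum]
    refine Finset.sum_congr rfl fun γ _ => ?_
    rw [MvPolynomial.monomial_mul]
  rw [hq]
  refine (sW_sum_le _ _).trans ?_
  rw [sW, Finset.mul_sum]
  refine Finset.sum_le_sum fun γ _ => ?_
  rw [sW_monomial]
  exact tW_mul_le _ _

/-- `sW (map C p) = Σ_β wt(coeff β p)` for `p ∈ ℤ[τ][X_σ]`. [folklore] -/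
private theorem sW_map_C (p : MvPolynomial σ (MvPolynomial τ ℤ)) :
    sW (MvPolynomial.map Polynomial.C p) = p.support.sum fun β => weight (p.coeff β) := by
  classical
  rw [sW_eq_sum_of_support_subset _ (MvPolynomial.support_map_subset _ _)]
  refine Finset.sum_congr rfl fun β _ => ?_
  rw [MvPolynomial.coeff_map, tW_C]

/-- The perturbed tails have the total weight of `F_i`. [folklore] -/
private theorem sW_pertTail_le {n : ℕ} (F : Fin n → MvPolynomial (Fin n) (MvPolynomial τ ℤ)) (i : Fin n) :
    sW (pertTail F i) ≤ (F i).support.sum fun β => weight ((F i).coeff β) := by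
  classical
  unfold pertTail
  rw [sW_neg, MvPolynomial.C_mul', sW_eq_sum_of_support_subset _
    ((MvPolynomial.support_smul).trans (MvPolynomial.support_map_subset _ _))]
  refine Finset.sum_le_sum fun β _ => ?_
  rw [MvPolynomial.coeff_smul, MvPolynomial.coeff_map, smul_eq_mul]
  refine (tW_mul_le _ _).trans ?_
  rw [tW_X, tW_C, one_mul]

/-- The box part of the total weight. [folklore] -/
private theorem sum_tW_coeff_boxExp_le {n D : ℕ} (q : MvPolynomial (Fin n) (Polynomial (MvPolynomial τ ℤ))) :
    ∑ b : Fin n → Fin D, tW (MvPolynomial.coeff (boxExp b) q) ≤ sW q := by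
  classical
  have h1 : ∑ b : Fin n → Fin D, tW (MvPolynomial.coeff (boxExp b) q) =
      ∑ β ∈ (Finset.univ : Finset (Fin n → Fin D)).image boxExp, tW (MvPolynomial.coeff β q) := by
    rw [Finset.sum_image fun b _ b' _ h => boxExp_injective h]
  rw [h1, sW_eq_sum_of_support_subset q (Finset.subset_union_left
    (s₂ := (Finset.univ : Finset (Fin n → Fin D)).image boxExp))]
  exact Finset.sum_le_sum_of_subset_of_nonneg Finset.subset_union_right fun _ _ _ => Nat.zero_le _

end SW

/-! ### Weight growth under rewriting -/

section Rewriting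

variable {n D : ℕ}

/-- One rewriting pass multiplies the total weight by at most `max 1 (max_i sW T_i)`. [folklore] -/
private theorem sW_reduceStep_le (T : Fin n → MvPolynomial (Fin n) (Polynomial (MvPolynomial τ ℤ))) {B : ℕ}
    (hB1 : 1 ≤ B) (hT : ∀ i, sW (T i) ≤ B) (p : MvPolynomial (Fin n) (Polynomial (MvPolynomial τ ℤ))) :
    sW (reduceStep D T p) ≤ B * sW p := by
  classical
  unfold reduceStep
  refine (sW_sum_le _ _).trans ?_
  rw [sW, Finset.mul_sum]
  refine Finset.sum_le_sum fun α _ => ?_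
  unfold rewriteExp
  split_ifs with h
  · rw [← mul_assoc, MvPolynomial.C_mul_monomial, mul_one]
    refine (sW_monomial_mul_le _ _ _).trans ?_
    rw [mul_comm]
    exact Nat.mul_le_mul_right _ (hT _)
  · rw [MvPolynomial.C_mul_monomial, mul_one, sW_monomial]
    exact Nat.le_mul_of_pos_left _ hB1

/-- `k` passes multiply the total weight by at most `B^k`. [folklore] -/
private theorem sW_iterate_reduceStep_le (T : Fin n → MvPolynomial (Fin n) (Polynomial (MvPolynomial τ ℤ)))
    {B : ℕ} (hB1 : 1 ≤ B) (hT : ∀ i, sW (T i) ≤ B) (k : ℕ)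
    (p : MvPolynomial (Fin n) (Polynomial (MvPolynomial τ ℤ))) :
    sW ((reduceStep D T)^[k] p) ≤ B ^ k * sW p := by
  induction k generalizing p with
  | zero => simp
  | succ k ih =>
    rw [Function.iterate_succ_apply', pow_succ]
    refine (sW_reduceStep_le T hB1 hT _).trans ?_
    calc B * sW ((reduceStep D T)^[k] p) ≤ B * (B ^ k * sW p) := Nat.mul_le_mul_left _ (ih p)
      _ = B ^ k * B * sW p := by ring

/-- **Column weights of the perturbed rewriting matrix** over `ℤ[τ]`. [folklore] -/
private theorem sum_tW_pertMatrix_le (F : Fin n → MvPolynomial (Fin n) (MvPolynomial τ ℤ)) {W Wu : ℕ}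
    (hW1 : 1 ≤ W) (hW : ∀ i, ((F i).support.sum fun β => weight ((F i).coeff β)) ≤ W)
    (u : MvPolynomial (Fin n) (MvPolynomial τ ℤ)) (hu : (u.support.sum fun β => weight (u.coeff β)) ≤ Wu)
    (k : ℕ) (b : Fin n → Fin D) :
    ∑ b' : Fin n → Fin D, tW (pertMatrix D F u k b' b) ≤ W ^ k * Wu := by
  classical
  unfold pertMatrix
  simp only [rewriteMatrix_apply]
  refine (sum_tW_coeff_boxExp_le _).trans ?_
  refine (sW_iterate_reduceStep_le (pertTail F) hW1 (fun i => (sW_pertTail_le F i).trans (hW i)) k _).trans ?_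
  refine Nat.mul_le_mul_left _ ?_
  rw [mul_comm]
  refine (sW_monomial_mul_le _ _ _).trans ?_
  rw [tW_one, one_mul, sW_map_C]
  exact hu

end Rewriting

/-! ### Total weight on `ℤ[τ][s][T]` and the characteristic polynomial -/

section BW

/-- `bW P`: the total weight of `P ∈ ℤ[τ][s][T]`. [folklore] -/
private def bW (P : Polynomial (Polynomial (MvPolynomial τ ℤ))) : ℕ := P.support.sum fun k => tW (P.coeff k)

/-- `bW` over a superset of the support. [folklore] -/
private theorem bW_eq_sum_of_support_subset (P : Polynomial (Polynomial (MvPolynomial τ ℤ))) {S : Finset ℕ}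
    (hS : P.support ⊆ S) : bW P = ∑ k ∈ S, tW (P.coeff k) := by
  unfold bW
  refine Finset.sum_subset hS fun k _ hk => ?_
  rw [Polynomial.notMem_support_iff.1 hk, tW_zero]

/-- Coefficients are bounded by `bW`. [folklore] -/
private theorem tW_coeff_le_bW (P : Polynomial (Polynomial (MvPolynomial τ ℤ))) (k : ℕ) : tW (P.coeff k) ≤ bW P := by
  classical
  by_cases hk : k ∈ P.support
  · exact Finset.single_le_sum (f := fun k => tW (P.coeff k)) (fun _ _ => Nat.zero_le _) hk
  · rw [Polynomial.notMem_support_iff.1 hk, tW_zero]; exact Nat.zero_le _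

/-- `bW 0 = 0`. [folklore] -/
@[simp] private theorem bW_zero : bW (0 : Polynomial (Polynomial (MvPolynomial τ ℤ))) = 0 := by simp [bW]

/-- Monomials. [folklore] -/
private theorem bW_monomial (k : ℕ) (a : Polynomial (MvPolynomial τ ℤ)) : bW (Polynomial.monomial k a) = tW a := by
  classical
  rcases eq_or_ne a 0 with rfl | ha
  · simp
  · rw [bW, Polynomial.support_monomial _ ha, Finset.sum_singleton, Polynomial.coeff_monomial, if_pos rfl]

/-- `bW (C a) = tW a`. [folklore] -/
@[simp] private theorem bW_C (a : Polynomial (MvPolynomial τ ℤ)) : bW (Polynomial.C a) = tW a := by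
  rw [← Polynomial.monomial_zero_left, bW_monomial]

/-- `bW T = 1`. [folklore] -/
@[simp] private theorem bW_X : bW (Polynomial.X : Polynomial (Polynomial (MvPolynomial τ ℤ))) = 1 := by
  rw [← Polynomial.monomial_one_one_eq_X, bW_monomial, tW_one]

/-- Subadditivity. [folklore] -/
private theorem bW_add_le (P Q : Polynomial (Polynomial (MvPolynomial τ ℤ))) : bW (P + Q) ≤ bW P + bW Q := by
  classical
  rw [bW_eq_sum_of_support_subset (P + Q) Polynomial.support_add,
    bW_eq_sum_of_support_subset P Finset.subset_union_left,
    bW_eq_sum_of_support_subset Q Finset.subset_union_right, ← Finset.sum_add_distrib]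
  exact Finset.sum_le_sum fun k _ => by rw [Polynomial.coeff_add]; exact tW_add_le _ _

/-- `bW (-P) = bW P`. [folklore] -/
@[simp] private theorem bW_neg (P : Polynomial (Polynomial (MvPolynomial τ ℤ))) : bW (-P) = bW P := by
  simp [bW, Polynomial.support_neg]

/-- `bW (P - Q) ≤ bW P + bW Q`. [folklore] -/
private theorem bW_sub_le (P Q : Polynomial (Polynomial (MvPolynomial τ ℤ))) : bW (P - Q) ≤ bW P + bW Q := by
  have h := bW_add_le P (-Q)
  rw [bW_neg] at h
  rw [show P - Q = P + -Q by ring]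
  exact h

/-- Finite sums. [folklore] -/
private theorem bW_sum_le {ι : Type*} (s : Finset ι) (f : ι → Polynomial (Polynomial (MvPolynomial τ ℤ))) :
    bW (∑ i ∈ s, f i) ≤ ∑ i ∈ s, bW (f i) := by
  classical
  induction s using Finset.cons_induction with
  | empty => simp
  | cons a s ha ih =>
    rw [Finset.sum_cons, Finset.sum_cons]
    exact (bW_add_le _ _).trans (Nat.add_le_add_left ih _)

/-- Submultiplicativity. [folklore] -/
private theorem bW_mul_le (P Q : Polynomial (Polynomial (MvPolynomial τ ℤ))) : bW (P * Q) ≤ bW P * bW Q := by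
  classical
  rw [Polynomial.mul_eq_sum_sum]
  refine (bW_sum_le _ _).trans ?_
  calc ∑ i ∈ P.support, bW (Q.sum fun j a => Polynomial.monomial (i + j) (P.coeff i * a))
      ≤ ∑ i ∈ P.support, ∑ j ∈ Q.support, tW (P.coeff i) * tW (Q.coeff j) := by
        refine Finset.sum_le_sum fun i _ => ?_
        rw [Polynomial.sum_def]
        refine (bW_sum_le _ _).trans (Finset.sum_le_sum fun j _ => ?_)
        rw [bW_monomial]
        exact tW_mul_le _ _
    _ = bW P * bW Q := by rw [bW, bW, Finset.sum_mul_sum]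

/-- Products. [folklore] -/
private theorem bW_prod_le {ι : Type*} (s : Finset ι) (f : ι → Polynomial (Polynomial (MvPolynomial τ ℤ))) :
    bW (∏ i ∈ s, f i) ≤ ∏ i ∈ s, bW (f i) := by
  classical
  induction s using Finset.cons_induction with
  | empty => rw [Finset.prod_empty, Finset.prod_empty, ← Polynomial.C_1, bW_C, tW_one]
  | cons a s ha ih =>
    rw [Finset.prod_cons, Finset.prod_cons]
    exact (bW_mul_le _ _).trans (Nat.mul_le_mul_left _ ih)

/-- `wt(z • b) ≤ wt(b)` for `|z| ≤ 1`. [folklore] -/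
private theorem weight_zsmul_le {z : ℤ} (hz : z.natAbs ≤ 1) (b : MvPolynomial τ ℤ) :
    weight (z • b) ≤ weight b := by
  classical
  rw [weight_eq_sum_of_support_subset (z • b) MvPolynomial.support_smul, weight]
  refine Finset.sum_le_sum fun m _ => ?_
  rw [MvPolynomial.coeff_smul, smul_eq_mul, Int.natAbs_mul]
  calc z.natAbs * (b.coeff m).natAbs ≤ 1 * (b.coeff m).natAbs := Nat.mul_le_mul_right _ hz
    _ = (b.coeff m).natAbs := one_mul _

/-- `tW (z • a) ≤ tW a` for `|z| ≤ 1`. [folklore] -/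
private theorem tW_zsmul_le {z : ℤ} (hz : z.natAbs ≤ 1) (a : Polynomial (MvPolynomial τ ℤ)) :
    tW (z • a) ≤ tW a := by
  classical
  rw [tW_eq_sum_of_support_subset (z • a) (Polynomial.support_smul _ _), tW]
  refine Finset.sum_le_sum fun j _ => ?_
  rw [Polynomial.coeff_smul]
  exact weight_zsmul_le hz _

/-- Signs do not raise the total weight. [folklore] -/
private theorem bW_units_smul_le (ε : ℤˣ) (P : Polynomial (Polynomial (MvPolynomial τ ℤ))) :
    bW (ε • P) ≤ bW P := by
  classical
  have hz : (ε : ℤ).natAbs ≤ 1 := by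
    rcases Int.units_eq_one_or ε with h | h <;> simp [h]
  rw [Units.smul_def, bW_eq_sum_of_support_subset ((ε : ℤ) • P) (Polynomial.support_smul _ _), bW]
  refine Finset.sum_le_sum fun k _ => ?_
  rw [Polynomial.coeff_smul]
  exact tW_zsmul_le hz _

/-- **Total weight of a characteristic polynomial**: `bW (charpoly M) ≤ Π_i (1 + Σ_j tW(M j i))`.
[folklore] -/
private theorem bW_charpoly_le {ι : Type*} [Fintype ι] [DecidableEq ι]
    (M : Matrix ι ι (Polynomial (MvPolynomial τ ℤ))) :
    bW M.charpoly ≤ ∏ i, (1 + ∑ j, tW (M j i)) := by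
  classical
  rw [Matrix.charpoly, Matrix.det_apply]
  refine (bW_sum_le _ _).trans ?_
  have hentry : ∀ j i, bW (M.charmatrix j i) ≤ (if j = i then 1 else 0) + tW (M j i) := by
    intro j i
    rw [Matrix.charmatrix_apply, Matrix.diagonal_apply]
    split_ifs with h
    · exact (bW_sub_le _ _).trans (by rw [bW_X, bW_C])
    · rw [zero_sub, bW_neg, bW_C, zero_add]
  calc ∑ σ : Equiv.Perm ι, bW (Equiv.Perm.sign σ • ∏ i, M.charmatrix (σ i) i)
      ≤ ∑ σ : Equiv.Perm ι, ∏ i, ((if σ i = i then 1 else 0) + tW (M (σ i) i)) := by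
        refine Finset.sum_le_sum fun σ _ => ?_
        refine (bW_units_smul_le _ _).trans ?_
        exact (bW_prod_le _ _).trans (Finset.prod_le_prod' fun i _ => hentry _ _)
    _ ≤ ∏ i, ∑ j, ((if j = i then 1 else 0) + tW (M j i)) :=
        sum_perm_prod_le_prod_sum (fun j i => (if j = i then 1 else 0) + tW (M j i))
    _ = ∏ i, (1 + ∑ j, tW (M j i)) := by
        refine Finset.prod_congr rfl fun i _ => ?_
        rw [Finset.sum_add_distrib, Finset.sum_ite_eq' Finset.univ i, if_pos (Finset.mem_univ i)]

/-- The coefficients of the leading `s`-form are coefficients of coefficients of `P`: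
`Σ_k wt((sLead P).coeff k) ≤ bW P`. [folklore] -/
private theorem sum_weight_coeff_sLead_le (P : Polynomial (Polynomial (MvPolynomial τ ℤ))) :
    ((sLead P).support.sum fun k => weight ((sLead P).coeff k)) ≤ bW P := by
  classical
  have hsupp : (sLead P).support ⊆ P.support := by
    intro k hk
    rw [Polynomial.mem_support_iff] at hk ⊢
    intro h0
    apply hk
    rw [coeff_sLead, h0, Polynomial.coeff_zero]
  calc ((sLead P).support.sum fun k => weight ((sLead P).coeff k))
      ≤ P.support.sum fun k => weight ((sLead P).coeff k) :=
        Finset.sum_le_sum_of_subset_of_nonneg hsupp fun _ _ _ => Nat.zero_le _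
    _ ≤ P.support.sum fun k => tW (P.coeff k) := Finset.sum_le_sum fun k _ => by
        rw [coeff_sLead]; exact weight_coeff_le_tW _ _
    _ = bW P := rfl

end BW

/-! ### The height bound -/

section Main

variable {n D : ℕ}

/-- **Height of the leading `s`-form of the perturbed characteristic polynomial over `ℤ[τ]`.**
For a square system `F_1, …, F_n ∈ ℤ[τ][X_1, …, X_n]` of total weights `≤ W` (`W ≥ 1`), `u` of
total weight `≤ Wᵤ` and `k` rewriting passes, the total weight of `Q_u = sLead (pertCharpoly D F u k)`
is `≤ (1 + W^k · Wᵤ)^(Dⁿ)` — Bürgisser's `log wt = d^{O(n)} log w`, uniformly in the parameters.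
[cite: Burgisser2000TCS, Thm. 4.5 p. 82] -/
theorem sum_weight_coeff_sLead_pertCharpoly_le (F : Fin n → MvPolynomial (Fin n) (MvPolynomial τ ℤ))
    {W Wu : ℕ} (hW1 : 1 ≤ W) (hW : ∀ i, ((F i).support.sum fun β => weight ((F i).coeff β)) ≤ W)
    (u : MvPolynomial (Fin n) (MvPolynomial τ ℤ)) (hu : (u.support.sum fun β => weight (u.coeff β)) ≤ Wu)
    (k : ℕ) :
    ((sLead (pertCharpoly D F u k)).support.sum fun j => weight ((sLead (pertCharpoly D F u k)).coeff j)) ≤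
      (1 + W ^ k * Wu) ^ (D ^ n) := by
  classical
  refine (sum_weight_coeff_sLead_le _).trans ?_
  unfold pertCharpoly
  refine (bW_charpoly_le _).trans ?_
  calc ∏ b : Fin n → Fin D, (1 + ∑ b', tW (pertMatrix D F u k b' b))
      ≤ ∏ _b : Fin n → Fin D, (1 + W ^ k * Wu) :=
        Finset.prod_le_prod' fun b _ => Nat.add_le_add_left (sum_tW_pertMatrix_le F hW1 hW u hu k b) 1
    _ = (1 + W ^ k * Wu) ^ (D ^ n) := by
        rw [Finset.prod_const, Finset.card_univ, Fintype.card_fun, Fintype.card_fin, Fintype.card_fin]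

/-- **Per-coefficient form**: every coefficient of `Q_u ∈ ℤ[τ][T]` has weight
`≤ (1 + W^k · Wᵤ)^(Dⁿ)`. [cite: Burgisser2000TCS, Thm. 4.5 p. 82] -/
theorem weight_coeff_sLead_pertCharpoly_le (F : Fin n → MvPolynomial (Fin n) (MvPolynomial τ ℤ))
    {W Wu : ℕ} (hW1 : 1 ≤ W) (hW : ∀ i, ((F i).support.sum fun β => weight ((F i).coeff β)) ≤ W)
    (u : MvPolynomial (Fin n) (MvPolynomial τ ℤ)) (hu : (u.support.sum fun β => weight (u.coeff β)) ≤ Wu)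
    (k j : ℕ) :
    weight ((sLead (pertCharpoly D F u k)).coeff j) ≤ (1 + W ^ k * Wu) ^ (D ^ n) := by
  classical
  refine le_trans ?_ (sum_weight_coeff_sLead_pertCharpoly_le F hW1 hW u hu k)
  by_cases hj : j ∈ (sLead (pertCharpoly D F u k)).support
  · exact Finset.single_le_sum (f := fun j => weight ((sLead (pertCharpoly D F u k)).coeff j))
      (fun _ _ => Nat.zero_le _) hj
  · rw [Polynomial.notMem_support_iff.1 hj, weight_zero]; exact Nat.zero_le _

end Main

end Literature.Computability.AlgebraicComplexity

end
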